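import Summits.MatrixMultiplication.MatrixMultiplication.Theorems.LittleCwFarEdgeBound
import Literature.Computability.AlgebraicComplexity.AsymptoticRankMultiplesMatMul
import Literature.Computability.AlgebraicComplexity.RectangularExponentHomogeneity
import Literature.Computability.AlgebraicComplexity.RectangularExponentSymmetry
import Literature.Computability.AlgebraicComplexity.RectangularExponentInformationBound
import HarnessLib

/-!
# Route `SaturationLadder` — the GENERAL-SHAPE little-CW laser bound (decomp-mm lens 1 «grading /
quantitative ladder», gen 24; chain file 1/2, route-free helper: imports NO `Theses` file)

For the little Coppersmith–Winograd tensor `cw_q = Σᵢ (x₀yᵢzᵢ + xᵢy₀zᵢ + xᵢyᵢz₀)` and EVERY integer shape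
`(a, b, c)` with `1 ≤ a ≤ b, c`:

  `R̃(cw_q) ≤ r ⟹ ω(a, b, c) ≤ (a + b + c) · (log r − h(a/(a+b+c))) / log q`      (`littleCwRectBound`, def-free)

(`h` = natural binary entropy `Real.binEntropy`).  The tree had the two special shapes `(1,1,1)`
(`3(log r − h(1/3))/log q = log_q(4r³/27)`, BCS 1997 Thm. 15.41, inside `CoppersmithWinograd1990Proofs`) and `(1,1,k)`
(`Theorems.LittleCwFarEdgeBound.littleCwFarEdgeBound`, decomp-mm lens 2: the far-rectangular weighting); this module
proves the bound for all shapes by running the SAME landed chain with a general 3-letter type `(La, Lb, Lc)`: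
* **B1′** `lcwDiagonal₃` — a free diagonal of the joint type with arbitrary pattern counts `(m₁, m₂, m₃)`
  (`exists_free_diagonal_jointType_card`, Le Gall 2014 App. A.3), size `≥ 2^{N(min_m H(P_m) − Γ)}/loss(N)`;
* **B2′** `lcwEntropy₃` — the three marginal entropies are `h(m₂/N), h(m₃/N), h(m₁/N)` and `Γ = 0` (a law on the
  little support is determined by its marginals; product form), so `log 2 · (min − Γ) ≥ h(m_min/N)` by the
  elementary `binEntropy_le_of_le_of_add_le_one` (`p ≤ p′`, `p + p′ ≤ 1 ⟹ h(p) ≤ h(p′)`);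
* **A, C** are the landed `lcwRectRestriction` (already general) and `lcwThreshold` (with `m := a`, `N₀ := a+b+c`);
* **D′** the ω-chain uses the landed general Schönhage inequality `advxxz2025_thm32`
  (`t·q^{ω(a,b,c)} ≤ R̃(⟨t⟩ ⊗ ⟨q^a,q^b,q^c⟩)`) and homogeneity `omegaRect_smul` in place of the `(1,1,k)`-only
  `mul_rpow_omegaRect_le_asymptoticRank`.
Consistency: `littleCwFarEdgeBound_of_rect` re-derives lens 2's `LittleCwFarEdgeBound` (by name) as the shape
`(1,1,k)`.  Chain file 2 (`SaturationLadderLittleCwThin`) reads off the THIN SWEET-SPOT SEGMENT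
`ω(A, B, qB − A) = qB` under `R̃(cw_q) = q+1` (from the far point `(1,1,q−1)` through the α-point `(q,2,q)`), its
`η`-graded defect, and `Flat(cw_q) ⟹ α ≥ 2/q`.  Support module beneath the crux `SubexpSaturation`
(stmt-MatrixMultiplication-25909: thin tight points `ω(1,t,r) = 1 + r` are its currency); closes no item; imports only
BUILT modules. [cite: BurgisserClausenShokrollahi1997, Thm. 15.41; CoppersmithWinograd1990, §6; LeGall2014, Appendix A.3;
AlmanDuanVassilevskaWilliamsXuXuZhou2025, Thm. 3.2]
-/

set_option linter.dupNamespace false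

noncomputable section

open Finset
open scoped BigOperators

namespace Summit.MatrixMultiplication.MatrixMultiplication.Theorems.SaturationLadderLittleCwRect

open Literature.Computability.AlgebraicComplexity
open Literature.Barriers.MatrixMultiplication
open Summit.MatrixMultiplication.MatrixMultiplication.Theorems.LittleCwFarEdgeBound
  (lcwSupport₃ mem_lcwSupport₃_iff lcwSupport₃_sum lcwRectRestriction lcwThreshold cwTensor_ne_zero
    LittleCwFarEdgeBound)  -- landed, imported
open Summit.MatrixMultiplication.MatrixMultiplication.Theorems.FarEdgeDescentLogRate
  (shannon₃ log_two_mul_shannonEntropy_vec3 shannon₃_two)  -- landed, imported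

/-! ## Layer B1′ — a large free diagonal of a general 3-letter joint type -/

section LayerB

/-- **B1′.** For pattern counts `m₁, m₂, m₃` of `(1,1,0), (0,1,1), (1,0,1)` with `m₁ + m₂ + m₃ = N ≥ 1` and the law
`P = Q/N`, there is a family `Δ` of triples of level words of `cw_q^{⊗N}`, coordinatewise in the little support, of
that joint type, forming a free diagonal, with `2^{N (min_m H(P_m) − Γ_S(P))} ≤ |Δ| · (N+1)^63 · 192 · exp(4 √(log 6 + N log 27))`
(`exists_free_diagonal_jointType_card` for `S = lcwSupport₃ ⊆ Fin 3³`, `b = 2`; the `(M, M, kM)` case is lens 2's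
`lcwDiagonalRaw`). [cite: LeGall2014, Appendix A.3] -/
theorem lcwDiagonal₃ :
    ∀ m₁ m₂ m₃ N : ℕ, 0 < N → m₁ + m₂ + m₃ = N →
      ∀ P : Fin 3 × Fin 3 × Fin 3 → ℝ,
      (∀ x, P x = ((if x = (1, 1, 0) then m₁ else if x = (0, 1, 1) then m₂
          else if x = (1, 0, 1) then m₃ else 0 : ℕ) : ℝ) / (N : ℝ)) →
      ∃ Δ : Finset ((Fin N → Fin 3) × (Fin N → Fin 3) × (Fin N → Fin 3)),
        (∀ δ ∈ Δ, ∀ ρ, labelSeq δ ρ ∈ lcwSupport₃) ∧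
        (∀ δ ∈ Δ, letterCount (labelSeq δ) (1, 1, 0) = m₁ ∧ letterCount (labelSeq δ) (0, 1, 1) = m₂ ∧
          letterCount (labelSeq δ) (1, 0, 1) = m₃) ∧
        (∀ δ ∈ Δ, ∀ δ' ∈ Δ, ∀ δ'' ∈ Δ, (∀ ρ, (δ.1 ρ, δ'.2.1 ρ, δ''.2.2 ρ) ∈ lcwSupport₃) →
          δ = δ' ∧ δ' = δ'') ∧
        (2 : ℝ) ^ ((N : ℝ) *
            (min (shannonEntropy (marginalDist₁ P))
              (min (shannonEntropy (marginalDist₂ P)) (shannonEntropy (marginalDist₃ P))) -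
              maxEntropyPenalty lcwSupport₃ P)) ≤
          (Δ.card : ℝ) * ((N : ℝ) + 1) ^ 63 * 192 *
            Real.exp (4 * Real.sqrt (Real.log 6 + (N : ℝ) * Real.log 27)) := by
  intro m₁ m₂ m₃ N hN hNdef P hP
  classical
  -- tightness data (`i + j + l = 2` on the support)
  have hinj : Function.Injective fun (i : Fin 3) (_ : Fin 1) => (i : ℤ) := by
    intro i i' h
    have h0 := congrFun h 0
    simp only [Nat.cast_inj] at h0
    exact Fin.ext h0
  have hinjγ : Function.Injective fun (l : Fin 3) (_ : Fin 1) => (l : ℤ) - 2 := by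
    intro l l' h
    have h0 := congrFun h 0
    simp only [sub_left_inj, Nat.cast_inj] at h0
    exact Fin.ext h0
  have hbd : ∀ (i : Fin 3) (ρ : Fin 1), |((fun (i : Fin 3) (_ : Fin 1) => (i : ℤ)) i ρ)| ≤ (2 : ℕ) := by
    intro i ρ
    have := i.isLt
    simp only [Nat.cast_ofNat, Nat.abs_cast]
    omega
  have htight : ∀ x ∈ lcwSupport₃, ∀ ρ : Fin 1,
      (fun (i : Fin 3) (_ : Fin 1) => (i : ℤ)) x.1 ρ + (fun (j : Fin 3) (_ : Fin 1) => (j : ℤ)) x.2.1 ρ +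
        (fun (l : Fin 3) (_ : Fin 1) => (l : ℤ) - 2) x.2.2 ρ = 0 := by
    intro x hx ρ
    have hs := lcwSupport₃_sum hx
    simp only
    omega
  -- the joint type `Q`
  obtain ⟨Q, hQdef⟩ : ∃ Q : Fin 3 × Fin 3 × Fin 3 → ℕ, Q = fun x =>
      if x = (1, 1, 0) then m₁ else if x = (0, 1, 1) then m₂ else if x = (1, 0, 1) then m₃ else 0 :=
    ⟨_, rfl⟩
  have hQS : ∀ x, x ∉ lcwSupport₃ → Q x = 0 := by
    intro x hx
    rw [mem_lcwSupport₃_iff] at hx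
    push Not at hx
    obtain ⟨h1, h2, h3⟩ := hx
    simp [hQdef, h1, h2, h3]
  have hQ : ∑ x, Q x = N := by
    rw [sum_triple_eq, hQdef, ← hNdef]
    simp [Fin.sum_univ_three]
    omega
  have hP' : ∀ x, P x = (Q x : ℝ) / (N : ℝ) := by
    intro x
    rw [hQdef]
    exact hP x
  obtain ⟨Δ, hΔQ, hfree, hsize⟩ := exists_free_diagonal_jointType_card lcwSupport₃ (r := 1) (b := 2)
    (fun (i : Fin 3) (_ : Fin 1) => (i : ℤ)) (fun (j : Fin 3) (_ : Fin 1) => (j : ℤ))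
    (fun (l : Fin 3) (_ : Fin 1) => (l : ℤ) - 2) hinj hinj hinjγ hbd hbd htight hN Q hQS hQ P hP'
  have hQδ : ∀ δ ∈ Δ, letterCount (labelSeq δ) = Q := fun δ hδ => (Finset.mem_filter.1 (hΔQ hδ)).2
  refine ⟨Δ, ?_, ?_, hfree, ?_⟩
  · intro δ hδ ρ
    by_contra hρ
    have h0 := hQS _ hρ
    rw [← hQδ δ hδ] at h0
    exact (letterCount_pos_of_apply (labelSeq δ) ρ).ne' h0
  · intro δ hδ
    rw [hQδ δ hδ, hQdef]
    simp
  · refine hsize.trans_eq ?_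
    have hmax : (max 2 1 : ℕ) = 2 := by decide
    generalize (N : ℝ) = Nr
    simp only [Fintype.card_prod, Fintype.card_fin, hmax]
    norm_num
    simp only [mul_assoc]

/-! ## Layer B2′ — marginals and entropies of a general 3-letter law, `Γ = 0` -/

/-- The three marginals of the 3-letter law with masses `p₁, p₂, p₃` on `(1,1,0), (0,1,1), (1,0,1)`:
party 1 sees `(p₂, p₁ + p₃)`, party 2 sees `(p₃, p₁ + p₂)`, party 3 sees `(p₁, p₂ + p₃)`. -/
theorem marginalDist_lcw₃ {p₁ p₂ p₃ : ℝ} {P : Fin 3 × Fin 3 × Fin 3 → ℝ}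
    (hP : ∀ x, P x = if x = (1, 1, 0) then p₁ else if x = (0, 1, 1) then p₂
      else if x = (1, 0, 1) then p₃ else 0) :
    marginalDist₁ P = ![p₂, p₁ + p₃, 0] ∧ marginalDist₂ P = ![p₃, p₁ + p₂, 0] ∧
      marginalDist₃ P = ![p₁, p₂ + p₃, 0] := by
  refine ⟨?_, ?_, ?_⟩ <;> funext i <;> fin_cases i <;>
    simp [marginalDist₁, marginalDist₂, marginalDist₃, Fin.sum_univ_three, hP] <;> ring

/-- **Monotonicity of the binary entropy across `1/2`**: `0 ≤ p ≤ p′` and `p + p′ ≤ 1` give `h(p) ≤ h(p′)`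
(if `p′ ≤ 1/2` by monotonicity on `[0, 1/2]`; else `h(p′) = h(1 − p′)` and `p ≤ 1 − p′ < 1/2`). [folklore] -/
theorem binEntropy_le_of_le_of_add_le_one {p p' : ℝ} (h0 : 0 ≤ p) (hle : p ≤ p') (hs : p + p' ≤ 1) :
    Real.binEntropy p ≤ Real.binEntropy p' := by
  rcases le_or_gt p' 2⁻¹ with h | h
  · exact Real.binEntropy_strictMonoOn.monotoneOn ⟨h0, by linarith⟩ ⟨h0.trans hle, h⟩ hle
  · rw [← Real.binEntropy_one_sub p']
    refine Real.binEntropy_strictMonoOn.monotoneOn ⟨h0, ?_⟩ ⟨by linarith, ?_⟩ (by linarith)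
    · have : (2 : ℝ)⁻¹ = 1 / 2 := by norm_num
      linarith
    · have : (2 : ℝ)⁻¹ = 1 / 2 := by norm_num
      linarith

/-- **B2′.** For the 3-letter type `(m₁, m₂, m₃)/N` with `1 ≤ m₁ ≤ m₂, m₃`, `N = m₁ + m₂ + m₃`:
`h(m₁/N) ≤ log 2 · (min_m H_bits(P_m) − Γ_S(P))` (the marginal entropies are `h(m₂/N), h(m₃/N), h(m₁/N)`,
`Γ_S(P) = 0` by product form, and `h(m₁/N)` is the least of the three by `binEntropy_le_of_le_of_add_le_one`). -/
theorem lcwEntropy₃ :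
    ∀ m₁ m₂ m₃ N : ℕ, 1 ≤ m₁ → m₁ ≤ m₂ → m₁ ≤ m₃ → m₁ + m₂ + m₃ = N →
      ∀ P : Fin 3 × Fin 3 × Fin 3 → ℝ,
      (∀ x, P x = ((if x = (1, 1, 0) then m₁ else if x = (0, 1, 1) then m₂
          else if x = (1, 0, 1) then m₃ else 0 : ℕ) : ℝ) / (N : ℝ)) →
      Real.binEntropy ((m₁ : ℝ) / (N : ℝ)) ≤
        Real.log 2 * (min (shannonEntropy (marginalDist₁ P))
          (min (shannonEntropy (marginalDist₂ P)) (shannonEntropy (marginalDist₃ P))) -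
          maxEntropyPenalty lcwSupport₃ P) := by
  intro m₁ m₂ m₃ N h1 h12 h13 hNdef P hP
  have hN0 : (0 : ℝ) < N := by exact_mod_cast (by omega : 0 < N)
  have hNne : (N : ℝ) ≠ 0 := hN0.ne'
  set p₁ : ℝ := (m₁ : ℝ) / (N : ℝ) with hp₁
  set p₂ : ℝ := (m₂ : ℝ) / (N : ℝ) with hp₂
  set p₃ : ℝ := (m₃ : ℝ) / (N : ℝ) with hp₃
  have hm₁ : (1 : ℝ) ≤ m₁ := by exact_mod_cast h1
  have hm₂ : (1 : ℝ) ≤ m₂ := by exact_mod_cast (h1.trans h12)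
  have hm₃ : (1 : ℝ) ≤ m₃ := by exact_mod_cast (h1.trans h13)
  have hp₁0 : 0 < p₁ := by rw [hp₁]; exact div_pos (by linarith) hN0
  have hp₂0 : 0 < p₂ := by rw [hp₂]; exact div_pos (by linarith) hN0
  have hp₃0 : 0 < p₃ := by rw [hp₃]; exact div_pos (by linarith) hN0
  have hsum1 : p₁ + p₂ + p₃ = 1 := by
    have hNr : (N : ℝ) = (m₁ : ℝ) + m₂ + m₃ := by rw [← hNdef]; push_cast; ring
    rw [hp₁, hp₂, hp₃, hNr]
    field_simp
  have h12' : p₁ ≤ p₂ := by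
    rw [hp₁, hp₂]; exact div_le_div_of_nonneg_right (by exact_mod_cast h12) hN0.le
  have h13' : p₁ ≤ p₃ := by
    rw [hp₁, hp₃]; exact div_le_div_of_nonneg_right (by exact_mod_cast h13) hN0.le
  -- the law with real masses
  have hPr : ∀ x, P x = if x = (1, 1, 0) then p₁ else if x = (0, 1, 1) then p₂
      else if x = (1, 0, 1) then p₃ else 0 := by
    intro x
    rw [hP x]
    split_ifs
    · simp [hp₁]
    · simp [hp₂]
    · simp [hp₃]
    · simp
  have hoff : ∀ x, x ∉ lcwSupport₃ → P x = 0 := by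
    intro x hx
    rw [mem_lcwSupport₃_iff] at hx
    push Not at hx
    obtain ⟨e1, e2, e3⟩ := hx
    rw [hPr x]
    simp [e1, e2, e3]
  have hnonneg : ∀ x, 0 ≤ P x := by
    intro x
    rw [hP x]
    positivity
  have hsum : ∑ x, P x = 1 := by
    rw [sum_triple_eq]
    simp only [Fin.sum_univ_three, hPr]
    simp
    linarith
  have hsimp : P ∈ stdSimplex ℝ (Fin 3 × Fin 3 × Fin 3) := ⟨hnonneg, hsum⟩
  -- `Γ_S(P) = 0`: product form `P(i,j,l) = f i · g j · h l` on the support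
  have hpen : maxEntropyPenalty lcwSupport₃ P = 0 := by
    refine maxEntropyPenalty_eq_zero_of_mul lcwSupport₃ hsimp hoff ![p₂, 1, 1] ![p₃, 1, 1]
      ![p₁, 1, 1] ?_ ?_ ?_ ?_
    · intro x hx
      rw [mem_lcwSupport₃_iff] at hx
      rcases hx with rfl | rfl | rfl <;> simp [hp₂0]
    · intro x hx
      rw [mem_lcwSupport₃_iff] at hx
      rcases hx with rfl | rfl | rfl <;> simp [hp₃0]
    · intro x hx
      rw [mem_lcwSupport₃_iff] at hx
      rcases hx with rfl | rfl | rfl <;> simp [hp₁0]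
    · intro x hx
      rw [mem_lcwSupport₃_iff] at hx
      rcases hx with rfl | rfl | rfl <;> simp [hPr]
  obtain ⟨e₁, e₂, e₃⟩ := marginalDist_lcw₃ hPr
  have hlog : 0 < Real.log 2 := Real.log_pos one_lt_two
  rw [e₁, e₂, e₃, hpen, sub_zero]
  have f₁ : p₁ + p₃ = 1 - p₂ := by linarith
  have f₂ : p₁ + p₂ = 1 - p₃ := by linarith
  have f₃ : p₂ + p₃ = 1 - p₁ := by linarith
  have eH₁ : Real.log 2 * shannonEntropy ![p₂, p₁ + p₃, 0] = Real.binEntropy p₂ := by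
    rw [log_two_mul_shannonEntropy_vec3, f₁, shannon₃_two]
  have eH₂ : Real.log 2 * shannonEntropy ![p₃, p₁ + p₂, 0] = Real.binEntropy p₃ := by
    rw [log_two_mul_shannonEntropy_vec3, f₂, shannon₃_two]
  have eH₃ : Real.log 2 * shannonEntropy ![p₁, p₂ + p₃, 0] = Real.binEntropy p₁ := by
    rw [log_two_mul_shannonEntropy_vec3, f₃, shannon₃_two]
  rw [mul_min_of_nonneg _ _ hlog.le, mul_min_of_nonneg _ _ hlog.le, eH₁, eH₂, eH₃]
  exact le_min (binEntropy_le_of_le_of_add_le_one hp₁0.le h12' (by linarith))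
    (le_min (binEntropy_le_of_le_of_add_le_one hp₁0.le h13' (by linarith)) le_rfl)

end LayerB

/-! ## Layer D′ — the general-shape bound -/

section LayerD

/-- **The general-shape little-CW bound, PROVED**: for `q ≥ 2`, integers `1 ≤ a ≤ b, c` and every
`r ≥ R̃(cw_q)`, `ω(a, b, c) ≤ (a + b + c)(log r − h(a/(a+b+c)))/log q`.  By the symmetry of `ω` the least
exponent may sit in any slot (`omegaRect_swap₁₂/₁₃/rotate`).  Chain: `|Δ|·q^{ω(La,Lb,Lc)} ≤
R̃(⟨|Δ|⟩ ⊗ ⟨q^{La},q^{Lb},q^{Lc}⟩) ≤ R̃(cw_q^{⊗N}) ≤ R̃(cw_q)^N ≤ r^N ≤ |Δ|·(q^{La})^{E+δ}`, `N = L(a+b+c)`,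
`ω(La,Lb,Lc) = L·ω(a,b,c)`, layers A, B1′, B2′, C. [cite: BurgisserClausenShokrollahi1997, Thm. 15.41;
CoppersmithWinograd1990, §6; AlmanDuanVassilevskaWilliamsXuXuZhou2025, Thm. 3.2] -/
theorem littleCwRectBound (q a b c : ℕ) (hq : 2 ≤ q) (ha : 1 ≤ a) (hab : a ≤ b) (hac : a ≤ c)
    (r : ℝ) (hr : asymptoticRank (cwTensor ℂ q) ≤ r) :
    omegaRect ℂ a b c ≤
      ((a : ℝ) + b + c) * (Real.log r - Real.binEntropy ((a : ℝ) / ((a : ℝ) + b + c))) /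
        Real.log (q : ℝ) := by
  have hq1n : 1 ≤ q := by omega
  have hr1 : 1 ≤ r := (one_le_asymptoticRank_of_ne_zero (cwTensor_ne_zero (q := q) hq1n)).trans hr
  have hr0 : 0 < r := one_pos.trans_le hr1
  obtain ⟨N₀, hN₀⟩ : ∃ N₀ : ℕ, N₀ = a + b + c := ⟨_, rfl⟩
  have hN₀2 : 2 ≤ N₀ := by omega
  have hN₀r : (N₀ : ℝ) = (a : ℝ) + b + c := by rw [hN₀]; push_cast; ring
  have ha0 : (0 : ℝ) < a := by exact_mod_cast (by omega : 0 < a)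
  have hS0 : (0 : ℝ) < (a : ℝ) + b + c := by positivity
  have hq1 : (1 : ℝ) < q := by exact_mod_cast (lt_of_lt_of_le one_lt_two hq)
  have hq0 : (0 : ℝ) < q := zero_lt_one.trans hq1
  have hlogq : 0 < Real.log (q : ℝ) := Real.log_pos hq1
  set Hmin : ℝ := Real.binEntropy ((a : ℝ) / ((a : ℝ) + b + c)) with hHmin
  set E : ℝ := (Real.log r - Hmin) / ((((a : ℕ) : ℝ)) / (N₀ : ℝ) * Real.log (q : ℝ)) with hEdef
  have hE : ((a : ℝ) + b + c) * (Real.log r - Hmin) / Real.log (q : ℝ) = (a : ℝ) * E := by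
    rw [hEdef, hN₀r]
    field_simp
  rw [hE]
  refine le_of_forall_pos_lt_add fun δ hδ => ?_
  have hδa : 0 < δ / (2 * a) := by positivity
  obtain ⟨L, hL, hC⟩ := lcwThreshold q a N₀ hq ha hN₀2 r Hmin (δ / (2 * a)) hr0 hδa
  have hL0 : (0 : ℝ) < L := by exact_mod_cast (by omega : 0 < L)
  -- the scaled type `(La, Lb, Lc)`, `N = L N₀`
  have hNL : L * a + L * b + L * c = L * N₀ := by rw [hN₀]; ring
  have hNpos : 0 < L * N₀ := Nat.mul_pos (by omega) (by omega)
  set P : Fin 3 × Fin 3 × Fin 3 → ℝ := fun x =>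
    ((if x = (1, 1, 0) then L * a else if x = (0, 1, 1) then L * b
        else if x = (1, 0, 1) then L * c else 0 : ℕ) : ℝ) / (((L * N₀ : ℕ) : ℝ)) with hPdef
  have hPs : ∀ x, P x = ((if x = (1, 1, 0) then L * a else if x = (0, 1, 1) then L * b
        else if x = (1, 0, 1) then L * c else 0 : ℕ) : ℝ) / (((L * N₀ : ℕ) : ℝ)) := fun x => rfl
  have hLa1 : 1 ≤ L * a := Nat.mul_pos (by omega) (by omega)
  obtain ⟨Δ, hS, hcnt, hfree, hsize⟩ := lcwDiagonal₃ (L * a) (L * b) (L * c) (L * N₀) hNpos hNL P hPs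
  have hent := lcwEntropy₃ (L * a) (L * b) (L * c) (L * N₀) hLa1 (Nat.mul_le_mul_left L hab)
    (Nat.mul_le_mul_left L hac) hNL P hPs
  have hfrac : (((L * a : ℕ) : ℝ)) / (((L * N₀ : ℕ) : ℝ)) = (a : ℝ) / ((a : ℝ) + b + c) := by
    rw [hN₀]
    push_cast
    field_simp
  rw [hfrac] at hent
  -- `exp(N · Hmin) ≤ 2^{N (min H − Γ)} ≤ |Δ| · loss`
  set X : ℝ := min (shannonEntropy (marginalDist₁ P))
      (min (shannonEntropy (marginalDist₂ P)) (shannonEntropy (marginalDist₃ P))) -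
      maxEntropyPenalty lcwSupport₃ P with hX
  have hNn : (0 : ℝ) ≤ (((L * N₀ : ℕ) : ℝ)) := Nat.cast_nonneg _
  have hexp : Real.exp ((((L * N₀ : ℕ) : ℝ)) * Hmin) ≤ (2 : ℝ) ^ ((((L * N₀ : ℕ) : ℝ)) * X) := by
    rw [Real.rpow_def_of_pos two_pos, Real.exp_le_exp]
    calc (((L * N₀ : ℕ) : ℝ)) * Hmin ≤ (((L * N₀ : ℕ) : ℝ)) * (Real.log 2 * X) :=
          mul_le_mul_of_nonneg_left hent hNn
      _ = Real.log 2 * ((((L * N₀ : ℕ) : ℝ)) * X) := by ring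
  have hnum := hC Δ.card (hexp.trans hsize)
  -- the tensor layer and the `ω`-chain
  have hres := lcwRectRestriction q (L * a) (L * b) (L * c) (L * N₀) Δ hS hcnt hfree
  have hdeg : PolyDegeneratesTo (kroneckerPow (cwTensor ℂ q) (L * N₀))
      (kroneckerTensor (unitTensor ℂ Δ.card)
        (matMulTensor ℂ (q ^ (L * a)) (q ^ (L * b)) (q ^ (L * c)))) := hres.polyDegeneratesTo
  have hV : 1 ≤ Δ.card := by
    by_contra h0
    have h0' : Δ.card = 0 := by omega
    rw [h0', Nat.cast_zero, zero_mul, zero_mul, zero_mul] at hsize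
    exact absurd (hexp.trans hsize) (not_le.2 (Real.exp_pos _))
  have hV0 : (0 : ℝ) < (Δ.card : ℝ) := by exact_mod_cast (by omega : 0 < Δ.card)
  have h1 := advxxz2025_thm32 ℂ hq (L * a) (L * b) (L * c) hV
  have h2 := asymptoticRank_le_of_polyDegeneratesTo hdeg
  have h3' : asymptoticRank (kroneckerPow (cwTensor ℂ q) (L * N₀)) ≤ r ^ (L * N₀) :=
    (asymptoticRank_kroneckerPow_le _ hNpos).trans
      (pow_le_pow_left₀ (asymptoticRank_nonneg _) hr _)
  have hchain : (Δ.card : ℝ) * (q : ℝ) ^ omegaRect ℂ ((L * a : ℕ) : ℝ) ((L * b : ℕ) : ℝ) ((L * c : ℕ) : ℝ) ≤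
      (Δ.card : ℝ) * (((q ^ (L * a) : ℕ) : ℝ)) ^ (E + δ / (2 * a)) :=
    h1.trans (h2.trans (h3'.trans hnum))
  -- homogeneity `ω(La, Lb, Lc) = L · ω(a, b, c)` and `q^{La (E+δ')} = (q^{La})^{E+δ'}`
  have hsm : omegaRect ℂ ((L * a : ℕ) : ℝ) ((L * b : ℕ) : ℝ) ((L * c : ℕ) : ℝ) =
      (L : ℝ) * omegaRect ℂ a b c := by
    have h := omegaRect_smul ℂ hL (Nat.cast_nonneg a) (Nat.cast_nonneg b) (Nat.cast_nonneg c)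
    push_cast
    exact h
  have hqa : (((q ^ (L * a) : ℕ) : ℝ)) ^ (E + δ / (2 * a)) =
      (q : ℝ) ^ ((L : ℝ) * a * (E + δ / (2 * a))) := by
    rw [Real.rpow_mul hq0.le]
    congr 1
    push_cast
    rw [← Real.rpow_natCast]
    push_cast
    rfl
  rw [hsm, hqa] at hchain
  have h4 : (q : ℝ) ^ ((L : ℝ) * omegaRect ℂ a b c) ≤ (q : ℝ) ^ ((L : ℝ) * a * (E + δ / (2 * a))) :=
    le_of_mul_le_mul_left hchain hV0
  have h5 : (L : ℝ) * omegaRect ℂ a b c ≤ (L : ℝ) * a * (E + δ / (2 * a)) :=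
    (Real.rpow_le_rpow_left_iff hq1).1 h4
  rw [mul_assoc] at h5
  have h6 : omegaRect ℂ a b c ≤ (a : ℝ) * (E + δ / (2 * a)) := le_of_mul_le_mul_left h5 hL0
  have h7 : (a : ℝ) * (E + δ / (2 * a)) = (a : ℝ) * E + δ / 2 := by
    field_simp
  linarith

/-- **Consistency with lens 2**: the shape `(1, 1, k)` of `littleCwRectBound` is exactly
`Theorems.LittleCwFarEdgeBound.LittleCwFarEdgeBound` (re-derived here by name, not restated). -/
theorem littleCwFarEdgeBound_of_rect : LittleCwFarEdgeBound := by
  intro q k hq hk r hr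
  have h := littleCwRectBound q 1 1 k hq le_rfl le_rfl hk r hr
  have e1 : ((1 : ℕ) : ℝ) + ((1 : ℕ) : ℝ) + (k : ℝ) = (k : ℝ) + 2 := by push_cast; ring
  have e2 : (((1 : ℕ) : ℝ)) / (((1 : ℕ) : ℝ) + ((1 : ℕ) : ℝ) + (k : ℝ)) = 1 / ((k : ℝ) + 2) := by
    rw [e1]; push_cast; rfl
  rw [e2, e1] at h
  simpa using h

/-- The symmetric shape `(1, 1, 1)`: `R̃(cw_q) ≤ r ⟹ ω = ω(1,1,1) ≤ 3 (log r − h(1/3)) / log q` (BCS Thm. 15.41 in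
`ω(1,1,1)`-form: `3 h(1/3) = log(27/4)`). [cite: BurgisserClausenShokrollahi1997, Thm. 15.41] -/
theorem omegaRect_one_one_one_le_of_littleCw {q : ℕ} (hq : 2 ≤ q) {r : ℝ}
    (hr : asymptoticRank (cwTensor ℂ q) ≤ r) :
    omegaRect ℂ 1 1 1 ≤ 3 * (Real.log r - Real.binEntropy (1 / 3)) / Real.log (q : ℝ) := by
  have h := littleCwRectBound q 1 1 1 hq le_rfl le_rfl le_rfl r hr
  norm_num at h ⊢
  exact h

end LayerD

end Summit.MatrixMultiplication.MatrixMultiplication.Theorems.SaturationLadderLittleCwRect
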